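import Summits.HodgeConjecture.HodgeConjecture.Theorems.VHCAbelianSchemesRoadIsogenyPushforwardISemiregularCTransfer
import Summits.Ventures.HSemireg.HomComplexSigmaOfSchemeIso
import HarnessLib

/-!
# Road №4 (`VHCAbelianSchemesRoad`) — core (SC) of THEOREM T (crux stmt-HodgeConjecture-26512): the DEGREE-ONE SANITY of the derived
# direct image datum (L7a), the twist data (L7b) and the displayed inputs (At), (Tr), (Ext) of
# `isogenyPushforwardISemiregularCTransfer_of`

research route conditional on HC_CM; not a corollary; Q11.4-sentence-2 already refuted in dim ≥ 3.

core-SC gen 0 (director-hodge g14 R14.24, plate (SC); LEAD 163 BOOKED l.5521). `--supports stmt-HodgeConjecture-26512 --as helper`; closes NO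
stub or item; nothing here says (SC), THEOREM T, `HC_AV`, `HC_CM` or HC holds; HC_CM HELD. Companion of
`VHCAbelianSchemesRoadIsogenyPushforwardISemiregularCTransfer.lean` (the composition) and `VHCAbelianSchemesRoadSigmaTransferDerivedLiftingDatum.lean`
(the plumbing), same seat.

PURPOSE. The composition `isogenyPushforwardISemiregularCTransfer_of : ∀ R α, (At) → (Tr) → (Ext) → (SC)` displays two DATA — (L7a)
`IsogenyDerivedDirectImage A g` (model `Rg_*`) and (L7b) `IsogenyTwistPushforwardIso A g` — and three predicates on them. This file PROVES
that in DEGREE ONE (an endomorphism `g` whose direct image functor `g_*` is an equivalence of module categories; the identity) the data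
EXIST and the predicates' clauses ARE the landed isomorphism-case transports of the venture (`HomComplexSigmaOfSchemeIso`, pieces
(N1)–(N5)), so that the typed inputs have the intended, satisfiable SHAPE and ask, for `deg g ≥ 2`, exactly the identities that are
theorems in degree one:
* `isogenyDerivedDirectImageOfIsEquivalence` — (L7a) for `g_*` an equivalence: Mathlib's `mapDerivedCategory` ∕ `mapDerivedCategoryFactors`;
  `mapShiftedHom_isogenyDerivedDirectImageOfIsEquivalence` — its `g_{**}` IS the venture's `mapShiftedHom g_*` (rfl);
  `mapShiftedHom_bijective_of_isEquivalence` — the (Ext)-clause outright, in every degree (`mapShiftedHom_bijective`);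
* `isEquivalence_pushforward_id` — `(𝟙_A)_*` is an equivalence; `atiyahClassPushforwardCompat_id` — the (At)-clause for `𝟙_A` with
  `α = twistHodgeComplexPushforwardIso (Iso.refl A.X)` IS (N4) `mapShiftedHom_extMulAtiyahPower_comp`;
* **`sigmaTail_mapShiftedHom_of_schemeIso`** — for ANY isomorphism `e : X₀ ≅ X₁` of `S`-schemes and any `y : Q K ⟶ (Q (K ⊗ Ω^q))⟦q+2⟧`:
  `e_{**}(Q(unit)·Φ_K(y)·Q(Tr•_K)) = [Q u] ≫ Q(unit)·Φ_{e_*•K}(e_{**}y·[Q α_q])·Q(Tr•_{e_*•K}) ≫ [Q v⁻¹]⟦q+2⟧` — the assembly of (N2)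
  `map_unit_comp`, (N3) `mapShiftedHom_phi_comp`, (N5) `map_inv_comp_supertraceH` on the TAIL of `σ_q` (the venture's `mapShiftedHom_sigmaC` is
  this at `y = x·ι•·At(K)^q` followed by (N4)); hence `tracePushforwardCompat_id` — the (Tr)-clause for `𝟙_A` with the injective additive
  `ρ_q(t) = [Q u⁻¹] ≫ (𝟙)_{**}(t) ≫ [Q v]⟦q+2⟧` — and `exists_sigmaCompat_id` — the `σ`-compatibility for `𝟙_A` (`mapShiftedHom_sigmaC`).

References: [cite: BuchweitzFlenner2003, §3 (Atiyah class, trace), Def. 4.1 and §5 (I-semiregular)] [cite: Weibel1994, §10.4 and Cor. 10.4.7]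
[cite: Hartshorne1977, II §5 pp. 109–110 (direct images along an isomorphism)]. Bookkeeping in degree one (no printed statement typed verbatim).
-/

noncomputable section

-- `TopCat.Presheaf`/`Scheme.Modules` are not reducible (as in Mathlib's `AlgebraicGeometry/Modules/Sheaf.lean`).
set_option backward.isDefEq.respectTransparency false

open CategoryTheory CategoryTheory.Category CategoryTheory.Limits AlgebraicGeometry Opposite
open DerivedCategory AlgebraicGeometry.Scheme.Modules

namespace Summit.HodgeConjecture.HodgeConjecture.Ring2.SemiregularRepresentatives

set_option linter.dupNamespace false -- the cell's namespace repeats the summit name, as in every `Ring2*` file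

open Literature.AlgebraicGeometry Literature.AlgebraicGeometry.Modules Literature.AlgebraicGeometry.Motives
open Literature.AlgebraicGeometry.Motives.AbelianVariety Literature.AlgebraicGeometry.KTheory
open Summit.Ventures.HSemireg Summit.Ventures.HSemireg.HomComplex

/-! ## §1 The tail of `σ_q` along an isomorphism of the base scheme (pieces (N2), (N3), (N5) assembled for a general argument) -/

section SchemeIso

universe w₀ w₁ u

variable {S : Type u} [CommRing S] {X₀ X₁ : Over (Spec (CommRingCat.of S))} (e : X₀ ≅ X₁)
  (K : CochainComplex X₀.left.Modules ℤ) (a b : ℤ) [K.IsStrictlyGE a] [K.IsStrictlyLE b]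
  (hK : ∀ p, IsFiniteLocallyFree (K.X p))
  (hK' : ∀ p, IsFiniteLocallyFree ((((pushforward e.hom.left).mapHomologicalComplex (ComplexShape.up ℤ)).obj K).X p))
  [HasDerivedCategory.{w₀} X₀.left.Modules] [HasDerivedCategory.{w₁} X₁.left.Modules]

/-- **The tail of `σ_q` along an isomorphism `e` of `S`-schemes**: for every `y : Q K ⟶ (Q (K ⊗ Ω^q))⟦q+2⟧`,
`e_{**}(Q(unit)·Φ_K(y)·Q(Tr•_K)) = [Q u] ≫ Q(unit)·Φ_{e_*•K}(e_{**}(y)·[Q α_q])·Q(Tr•_{e_*•K}) ≫ [Q v⁻¹]⟦q+2⟧`, `u`, `v` the end isomorphisms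
`unitSingleIso`, `hodgeSingleIso`, `α_q = twistHodgeComplexPushforwardIso e q K` — (N2) for the unit, (N3) for `Φ`, (N5) for the supertrace
(the assembly of the venture's `mapShiftedHom_sigmaC`, run for a general `y` instead of `x·ι•·At(K)^q`). This is the (Tr)-clause of
`TracePushforwardCompat` in degree one. [cite: BuchweitzFlenner2003, §3 (trace) and Def. 4.1 (reading: σ is intrinsic to (X, K•))] -/
theorem sigmaTail_mapShiftedHom_of_schemeIso (q : ℕ) (y : ShiftedHom (Q.obj K) (Q.obj (twistHodgeComplex X₀ q K)) ((q : ℤ) + 2)) :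
    Summit.Ventures.HSemireg.mapShiftedHom (pushforward e.hom.left) (sigmaTail X₀ K a b hK q y) =
      Q.map (unitSingleIso e).hom ≫
        sigmaTail X₁ (((pushforward e.hom.left).mapHomologicalComplex (ComplexShape.up ℤ)).obj K) a b hK' q
          ((Summit.Ventures.HSemireg.mapShiftedHom (pushforward e.hom.left) y).comp
            (ShiftedHom.mk₀ (0 : ℤ) rfl (Q.map (twistHodgeComplexPushforwardIso e q K).hom)) (zero_add _)) ≫
        (shiftFunctor _ ((q + 2 : ℕ) : ℤ)).map (Q.map (hodgeSingleIso e q).inv) := by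
  -- (N3), solved for `e_{**}(Φ_K(y))`
  have h3 := mapShiftedHom_phi_comp e K a b hK hK' y
  have hΦ : Summit.Ventures.HSemireg.mapShiftedHom (pushforward e.hom.left)
      (shiftedHomMap (homFunctor X₀.left K) (homFunctor_isInvertedBy X₀ K a b hK) y) =
      Q.map (homFunctorOverPushforwardIso e K K).hom ≫
        shiftedHomMap (homFunctor X₁.left (((pushforward e.hom.left).mapHomologicalComplex (ComplexShape.up ℤ)).obj K))
          (homFunctor_isInvertedBy X₁ _ a b hK') (Summit.Ventures.HSemireg.mapShiftedHom (pushforward e.hom.left) y) ≫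
        (shiftFunctor _ ((q : ℤ) + 2)).map (Q.map (homFunctorOverPushforwardIso e K (twistHodgeComplex X₀ q K)).inv) := by
    rw [← cancel_mono ((shiftFunctor _ ((q : ℤ) + 2)).map (Q.map (homFunctorOverPushforwardIso e K (twistHodgeComplex X₀ q K)).hom)),
      Category.assoc, Category.assoc, ← Functor.map_comp, ← Functor.map_comp, Iso.inv_hom_id, CategoryTheory.Functor.map_id,
      CategoryTheory.Functor.map_id, Category.comp_id, h3]
  -- (N2) after `Q`
  have h2 : Q.map (((pushforward e.hom.left).mapHomologicalComplex (ComplexShape.up ℤ)).map (unit X₀.left K a b)) ≫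
      Q.map (homFunctorOverPushforwardIso e K K).hom =
      Q.map (unitSingleIso e).hom ≫
        Q.map (unit X₁.left (((pushforward e.hom.left).mapHomologicalComplex (ComplexShape.up ℤ)).obj K) a b) := by
    rw [← Functor.map_comp, ← Functor.map_comp, map_unit_comp e K a b]
  -- (N5) in the form `τ_L⁻¹ ≫ e_*•(Tr•_K) = 𝓗om•(K', α_q) ≫ Tr•_{K'} ≫ v⁻¹`, then after `Q` and the shift
  have h5 : (homFunctorOverPushforwardIso e K (twistHodgeComplex X₀ q K)).inv ≫
      ((pushforward e.hom.left).mapHomologicalComplex (ComplexShape.up ℤ)).map (supertraceH X₀ K hK q) =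
      (homFunctor X₁.left (((pushforward e.hom.left).mapHomologicalComplex (ComplexShape.up ℤ)).obj K)).map
          (twistHodgeComplexPushforwardIso e q K).hom ≫
        supertraceH X₁ (((pushforward e.hom.left).mapHomologicalComplex (ComplexShape.up ℤ)).obj K) hK' q ≫
          (hodgeSingleIso e q).inv := by
    rw [← cancel_epi ((homFunctor X₁.left (((pushforward e.hom.left).mapHomologicalComplex (ComplexShape.up ℤ)).obj K)).map
      (twistHodgeComplexPushforwardIso e q K).inv), ← Functor.map_comp_assoc, Iso.inv_hom_id, CategoryTheory.Functor.map_id,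
      Category.id_comp]
    exact map_inv_comp_supertraceH e K hK hK' q
  have h5S : (shiftFunctor _ ((q : ℤ) + 2)).map (Q.map (homFunctorOverPushforwardIso e K (twistHodgeComplex X₀ q K)).inv) ≫
      (shiftFunctor _ ((q : ℤ) + 2)).map (Q.map (((pushforward e.hom.left).mapHomologicalComplex (ComplexShape.up ℤ)).map
        (supertraceH X₀ K hK q))) =
      (shiftFunctor _ ((q : ℤ) + 2)).map (Q.map ((homFunctor X₁.left (((pushforward e.hom.left).mapHomologicalComplex
          (ComplexShape.up ℤ)).obj K)).map (twistHodgeComplexPushforwardIso e q K).hom)) ≫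
        (shiftFunctor _ ((q : ℤ) + 2)).map (Q.map (supertraceH X₁ (((pushforward e.hom.left).mapHomologicalComplex
          (ComplexShape.up ℤ)).obj K) hK' q)) ≫
          (shiftFunctor _ ((q : ℤ) + 2)).map (Q.map (hodgeSingleIso e q).inv) := by
    simp only [← Functor.map_comp, h5]
  -- assemble
  rw [sigmaTail, sigmaTail, Summit.Ventures.HSemireg.mapShiftedHom_comp, Summit.Ventures.HSemireg.mapShiftedHom_comp, unitQ, unitQ,
    Summit.Ventures.HSemireg.mapShiftedHom_mk₀, Summit.Ventures.HSemireg.mapShiftedHom_mk₀, comp_sigmaShape_comp,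
    shiftedHomMap_comp_mk₀]
  refine shiftedHom_comp_mk₀_congr _ _ _ _ _ ?_
  rw [ShiftedHom.mk₀_comp, ShiftedHom.mk₀_comp, ShiftedHom.comp_mk₀, hΦ]
  simp only [Functor.map_comp, Category.assoc]
  rw [reassoc_of% h2, h5S]

end SchemeIso

/-! ## §2 Degree one: the data exist and the displayed clauses are the landed isomorphism-case transports

For an endomorphism `g` whose direct image functor `g_*` is an EQUIVALENCE of module categories (an automorphism of `A`; an
isogeny of degree `1`), `g_*` is exact, the datum (L7a) is Mathlib's `mapDerivedCategory` (`DerivedLiftingDatum.ofExact` restricted to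
bounded complexes of vector bundles), its `g_{**}` is the venture's `mapShiftedHom g_*`, the (Ext)-clause holds outright
(`mapShiftedHom_bijective`), and — for `g = 𝟙_A`, `α` = the venture's `twistHodgeComplexPushforwardIso (Iso.refl A.X)` — the (At)-clause
is piece (N4) `mapShiftedHom_extMulAtiyahPower_comp` verbatim. Recorded to show that the SHAPE of (L7a), (L7b), (At), (Ext) is the
intended one: the degree-`≥ 2` case asks for exactly the same identities with `Rg_*` in place of `mapDerivedCategory`. -/

section Sanity

variable (A : AbelianVariety ℂ) (g : A ⟶ A) [(Scheme.Modules.pushforward (Hom.toSchemeHom g)).IsEquivalence]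

/-- **The datum (L7a) in degree one**: when `g_*` is an equivalence of module categories it is exact, and
`(g_*).mapDerivedCategory` with Mathlib's `mapDerivedCategoryFactors` is a derived direct image datum for `g` (on bounded complexes of
vector bundles, as on all complexes). [cite: Weibel1994, §10.4 and Cor. 10.4.7] -/
def isogenyDerivedDirectImageOfIsEquivalence : IsogenyDerivedDirectImage A g :=
  letI := HasDerivedCategory.standard A.X.left.Modules
  { functor := (Scheme.Modules.pushforward (Hom.toSchemeHom g)).mapDerivedCategory
    additive := inferInstance
    commShift := inferInstance
    iso := fun K _ => (Scheme.Modules.pushforward (Hom.toSchemeHom g)).mapDerivedCategoryFactors.app K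
    iso_hom_naturality := fun _ _ f => (Scheme.Modules.pushforward (Hom.toSchemeHom g)).mapDerivedCategoryFactors.hom.naturality f }

/-- In degree one `g_{**}` IS the venture's `mapShiftedHom g_*` (definitionally). [folklore] -/
theorem mapShiftedHom_isogenyDerivedDirectImageOfIsEquivalence {K L : CochainComplex A.X.left.Modules ℤ}
    (hK : IsBoundedVBComplex K) (hL : IsBoundedVBComplex L) {n : ℤ}
    (y : letI := HasDerivedCategory.standard A.X.left.Modules; ShiftedHom (Q.obj K) (Q.obj L) n) :
    letI := HasDerivedCategory.standard A.X.left.Modules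
    (isogenyDerivedDirectImageOfIsEquivalence A g).mapShiftedHom hK hL y =
      Summit.Ventures.HSemireg.mapShiftedHom (Scheme.Modules.pushforward (Hom.toSchemeHom g)) y :=
  rfl

/-- **The (Ext)-clause holds outright in degree one**: `g_{**}` is bijective on every `Hom_D(Q K, (Q L)⟦n⟧)` for an equivalence `g_*`
(`mapShiftedHom_bijective`; no (C^∨) needed — `Ker g(ℂ) = {1}`). [cite: Weibel1994, §10.4 and Cor. 10.4.7] -/
theorem mapShiftedHom_bijective_of_isEquivalence {K L : CochainComplex A.X.left.Modules ℤ} (hK : IsBoundedVBComplex K)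
    (hL : IsBoundedVBComplex L) (n : ℤ) :
    letI := HasDerivedCategory.standard A.X.left.Modules
    Function.Bijective ((isogenyDerivedDirectImageOfIsEquivalence A g).mapShiftedHom hK hL :
      ShiftedHom (Q.obj K) (Q.obj L) n → _) := by
  letI := HasDerivedCategory.standard A.X.left.Modules
  exact Summit.Ventures.HSemireg.mapShiftedHom_bijective (Scheme.Modules.pushforward (Hom.toSchemeHom g)) K L n

omit [(Scheme.Modules.pushforward (Hom.toSchemeHom g)).IsEquivalence] in
/-- `(𝟙_A)_*` is an equivalence of module categories (`pushforward` along the identity isomorphism; the tree's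
`isEquivalence_pushforward_hom`). [folklore] -/
theorem isEquivalence_pushforward_id : (Scheme.Modules.pushforward (Hom.toSchemeHom (𝟙 A))).IsEquivalence :=
  isEquivalence_pushforward_hom (Iso.refl A.X.left)

omit [(Scheme.Modules.pushforward (Hom.toSchemeHom g)).IsEquivalence] in
/-- **The (At)-clause holds for the identity isogeny** with `α` the venture's `twistHodgeComplexPushforwardIso (Iso.refl A.X)`: it is
piece (N4) `mapShiftedHom_extMulAtiyahPower_comp` of the isomorphism case, verbatim. [cite: BuchweitzFlenner2003, Def. 4.1] -/
theorem atiyahClassPushforwardCompat_id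
    {E : CochainComplex A.X.left.Modules ℤ} (hE : IsBoundedVBComplex E) (q : ℕ)
    (x : letI := HasDerivedCategory.standard A.X.left.Modules; ShiftedHom (Q.obj E) (Q.obj E) (2 : ℤ)) :
    haveI := isEquivalence_pushforward_id A
    letI := HasDerivedCategory.standard A.X.left.Modules
    ((isogenyDerivedDirectImageOfIsEquivalence A (𝟙 A)).mapShiftedHom hE (isBoundedVBComplex_twistHodgeComplex A hE q)
        (extMulAtiyahPower A.X E q x)).comp
        (ShiftedHom.mk₀ (0 : ℤ) rfl (Q.map (twistHodgeComplexPushforwardIso (Iso.refl A.X) q E).hom)) (zero_add _) =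
      extMulAtiyahPower A.X (endoPushforwardComplex A (𝟙 A) E) q
        ((isogenyDerivedDirectImageOfIsEquivalence A (𝟙 A)).mapShiftedHom hE hE x) := by
  haveI := isEquivalence_pushforward_id A
  letI := HasDerivedCategory.standard A.X.left.Modules
  exact mapShiftedHom_extMulAtiyahPower_comp (Iso.refl A.X) E q x

omit [(Scheme.Modules.pushforward (Hom.toSchemeHom g)).IsEquivalence] in
/-- **The `σ`-compatibility (the joint output of (At) and (Tr), `exists_sigmaCompat_of_atiyah_of_trace`) holds for the identity
isogeny**, unconditionally: `σ_q^{(𝟙)_*E}((𝟙)_{**} x) = ρ_q(σ_q^E(x))` with the injective additive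
`ρ_q(t) = [Q u⁻¹] ≫ (𝟙)_{**}(t) ≫ [Q v]⟦q+2⟧` (`u`, `v` the end isomorphisms `unitSingleIso`, `hodgeSingleIso`) — this is the venture's
`mapShiftedHom_sigmaC` at `e = Iso.refl A.X`, i.e. pieces (N1)–(N5) assembled. [cite: BuchweitzFlenner2003, Def. 4.1 and §5] -/
theorem exists_sigmaCompat_id (E : CochainComplex A.X.left.Modules ℤ) (a b : ℤ) [E.IsStrictlyGE a] [E.IsStrictlyLE b]
    (hE : ∀ i, IsFiniteLocallyFree (E.X i)) (hE' : ∀ i, IsFiniteLocallyFree ((endoPushforwardComplex A (𝟙 A) E).X i))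
    (q : ℕ) :
    haveI := isEquivalence_pushforward_id A
    letI := HasDerivedCategory.standard A.X.left.Modules
    ∃ ρ : sigmaTarget A.X q →+ sigmaTarget A.X q, Function.Injective ρ ∧
      ∀ x : ShiftedHom (Q.obj E) (Q.obj E) (2 : ℤ),
        sigmaC A.X (endoPushforwardComplex A (𝟙 A) E) a b hE' q
            ((isogenyDerivedDirectImageOfIsEquivalence A (𝟙 A)).mapShiftedHom (isBoundedVBComplex_of_strictly E a b hE)
              (isBoundedVBComplex_of_strictly E a b hE) x) =
          ρ (sigmaC A.X E a b hE q x) := by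
  haveI := isEquivalence_pushforward_id A
  letI := HasDerivedCategory.standard A.X.left.Modules
  let e : A.X ≅ A.X := Iso.refl A.X
  let ρ : sigmaTarget A.X q →+ sigmaTarget A.X q :=
    { toFun := fun t => Q.map (unitSingleIso e).inv ≫
          Summit.Ventures.HSemireg.mapShiftedHom (Scheme.Modules.pushforward e.hom.left) t ≫
        (shiftFunctor _ ((q + 2 : ℕ) : ℤ)).map (Q.map (hodgeSingleIso e q).hom)
      map_zero' := by
        simp only [Summit.Ventures.HSemireg.mapShiftedHom, ShiftedHom.map_zero, zero_comp, comp_zero]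
      map_add' := fun t t' => by
        simp only [Summit.Ventures.HSemireg.mapShiftedHom, ShiftedHom.map_add, Preadditive.add_comp, Preadditive.comp_add] }
  refine ⟨ρ, fun t t' htt' => ?_, fun x => ?_⟩
  · have h1 := (cancel_epi (Q.map (unitSingleIso e).inv)).1 htt'
    rw [cancel_mono] at h1
    exact Summit.Ventures.HSemireg.mapShiftedHom_injective (Scheme.Modules.pushforward e.hom.left) _ _ _ h1
  · have hσ := mapShiftedHom_sigmaC e E a b hE hE' q x
    change _ = Q.map (unitSingleIso e).inv ≫
      Summit.Ventures.HSemireg.mapShiftedHom (Scheme.Modules.pushforward e.hom.left) (sigmaC A.X E a b hE q x) ≫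
        (shiftFunctor _ ((q + 2 : ℕ) : ℤ)).map (Q.map (hodgeSingleIso e q).hom)
    rw [hσ]
    simp only [Category.assoc]
    rw [← Q.map_comp_assoc, Iso.inv_hom_id, ← (shiftFunctor _ ((q + 2 : ℕ) : ℤ)).map_comp, ← Q.map_comp, Iso.inv_hom_id]
    erw [CategoryTheory.Functor.map_id, CategoryTheory.Functor.map_id, CategoryTheory.Functor.map_id, Category.id_comp,
      Category.comp_id]
    rfl

omit [(Scheme.Modules.pushforward (Hom.toSchemeHom g)).IsEquivalence] in
/-- **The (Tr)-clause holds for the identity isogeny** with `α = twistHodgeComplexPushforwardIso (Iso.refl A.X)` and the injective additive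
`ρ_q(t) = [Q u⁻¹] ≫ (𝟙)_{**}(t) ≫ [Q v]⟦q+2⟧`: for EVERY `y : Q E• ⟶ (Q (E• ⊗ Ω^q))⟦q+2⟧`,
`ρ_q(Q(unit)·Φ_E(y)·Q(Tr•_E)) = Q(unit)·Φ_{(𝟙)_*E}((𝟙)_{**}y·[Q α_q])·Q(Tr•_{(𝟙)_*E})` (`sigmaTail_mapShiftedHom_of_schemeIso` at `e = Iso.refl A.X`;
certifies the SHAPE of `TracePushforwardCompat`). [cite: BuchweitzFlenner2003, §3 (trace) and Def. 4.1] -/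
theorem tracePushforwardCompat_id (E : CochainComplex A.X.left.Modules ℤ) (a b : ℤ) [E.IsStrictlyGE a] [E.IsStrictlyLE b]
    (hE : ∀ i, IsFiniteLocallyFree (E.X i)) (hE' : ∀ i, IsFiniteLocallyFree ((endoPushforwardComplex A (𝟙 A) E).X i))
    (q : ℕ) :
    haveI := isEquivalence_pushforward_id A
    letI := HasDerivedCategory.standard A.X.left.Modules
    ∃ ρ : sigmaTarget A.X q →+ sigmaTarget A.X q, Function.Injective ρ ∧
      ∀ y : ShiftedHom (Q.obj E) (Q.obj (twistHodgeComplex A.X q E)) ((q : ℤ) + 2),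
        ρ (sigmaTail A.X E a b hE q y) =
          sigmaTail A.X (endoPushforwardComplex A (𝟙 A) E) a b hE' q
            (((isogenyDerivedDirectImageOfIsEquivalence A (𝟙 A)).mapShiftedHom (isBoundedVBComplex_of_strictly E a b hE)
                (isBoundedVBComplex_twistHodgeComplex A (isBoundedVBComplex_of_strictly E a b hE) q) y).comp
              (ShiftedHom.mk₀ (0 : ℤ) rfl (Q.map (twistHodgeComplexPushforwardIso (Iso.refl A.X) q E).hom)) (zero_add _)) := by
  haveI := isEquivalence_pushforward_id A
  letI := HasDerivedCategory.standard A.X.left.Modules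
  let e : A.X ≅ A.X := Iso.refl A.X
  let ρ : sigmaTarget A.X q →+ sigmaTarget A.X q :=
    { toFun := fun t => Q.map (unitSingleIso e).inv ≫
          Summit.Ventures.HSemireg.mapShiftedHom (Scheme.Modules.pushforward e.hom.left) t ≫
        (shiftFunctor _ ((q + 2 : ℕ) : ℤ)).map (Q.map (hodgeSingleIso e q).hom)
      map_zero' := by
        simp only [Summit.Ventures.HSemireg.mapShiftedHom, ShiftedHom.map_zero, zero_comp, comp_zero]
      map_add' := fun t t' => by
        simp only [Summit.Ventures.HSemireg.mapShiftedHom, ShiftedHom.map_add, Preadditive.add_comp, Preadditive.comp_add] }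
  refine ⟨ρ, fun t t' htt' => ?_, fun y => ?_⟩
  · have h1 := (cancel_epi (Q.map (unitSingleIso e).inv)).1 htt'
    rw [cancel_mono] at h1
    exact Summit.Ventures.HSemireg.mapShiftedHom_injective (Scheme.Modules.pushforward e.hom.left) _ _ _ h1
  · have hT := sigmaTail_mapShiftedHom_of_schemeIso e E a b hE hE' q y
    have key : ∀ {X X' Y Y' : DerivedCategory A.X.left.Modules} (i₁ : X' ⟶ X) (i₂ : X ⟶ X') (_ : i₁ ≫ i₂ = 𝟙 X')
        (k₁ : Y ⟶ Y') (k₂ : Y' ⟶ Y) (_ : k₁ ≫ k₂ = 𝟙 Y) (M : X' ⟶ Y), i₁ ≫ i₂ ≫ M ≫ k₁ ≫ k₂ = M :=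
      fun i₁ i₂ hi k₁ k₂ hk M => by rw [reassoc_of% hi, hk, Category.comp_id]
    have hi : Q.map (unitSingleIso e).inv ≫ Q.map (unitSingleIso e).hom = 𝟙 _ := by
      rw [← Q.map_comp, Iso.inv_hom_id, CategoryTheory.Functor.map_id]
    have hk : (shiftFunctor (DerivedCategory A.X.left.Modules) ((q + 2 : ℕ) : ℤ)).map (Q.map (hodgeSingleIso e q).inv) ≫
        (shiftFunctor (DerivedCategory A.X.left.Modules) ((q + 2 : ℕ) : ℤ)).map (Q.map (hodgeSingleIso e q).hom) = 𝟙 _ := by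
      rw [← Functor.map_comp, ← Q.map_comp, Iso.inv_hom_id, CategoryTheory.Functor.map_id, CategoryTheory.Functor.map_id]
    change Q.map (unitSingleIso e).inv ≫
        Summit.Ventures.HSemireg.mapShiftedHom (Scheme.Modules.pushforward e.hom.left) (sigmaTail A.X E a b hE q y) ≫
          (shiftFunctor _ ((q + 2 : ℕ) : ℤ)).map (Q.map (hodgeSingleIso e q).hom) = _
    rw [hT]
    simp only [Category.assoc]
    refine (key _ _ hi _ _ hk _).trans ?_
    rfl

end Sanity

end Summit.HodgeConjecture.HodgeConjecture.Ring2.SemiregularRepresentatives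

end
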